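import Literature.NumberTheory.EllipticCurves.WZhang2014.KolyvaginNonvanishing
import Literature.NumberTheory.EllipticCurves.BSDSelmerCMPConverseRankOneProofs
import Literature.NumberTheory.EllipticCurves.IrreducibleModPQuadraticTwistProofs
import Literature.NumberTheory.EllipticCurves.NonEisensteinPrimeOfSurjective
import HarnessLib
import Literature.NumberTheory.EllipticCurves.HeegnerPointsKolyvaginLevelOneStructure

/-!
# Route `KolyvaginDepthDoor`, crux `KolyvaginDepthSupplyKN` (stmt-BirchSwinnertonDyer-22820) —
# SUPPLY AT LEVEL ONE: W. Zhang's mod-`p` structure lemma (Lemma 8.4 (1)) turns `Ш(E)[p] = 0`,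
# `Ш(E^{(d_K)})[p] = 0`, `rank E^{(d_K)}(ℚ) ≤ 1` into the crux's witness with its SIGNED rank clause

Helper file (`--supports stmt-BirchSwinnertonDyer-22820 --as helper`), route-independent (no `Theses`
import); it closes nothing and BSD is not proved by it.

The KN crux asks for a class at LEVEL ONE (`c_1(n₁) ≠ 0` in `H¹(K, E[p])`), so the `p^∞`/corank
calibration of the old crux (`kolyvaginDepthSupply_iff_shaCorankZeroSurj_nonCM`, BCGS 2026 Thm. 1 +
Kolyvagin 1991 Thm. 4, classes `c_M(n)` at some level `M ≤ M(n)`) does not transfer: `c_M(n) ≠ 0` does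
not give `c_1(n) ≠ 0`. The printed level-one input is W. Zhang 2014: Theorem 9.1 (= Thm. 1.1, the
mod-`p` system `κ = {c(n)}` is non-zero) together with Lemma 8.4 (1) (the `𝔽_p`-dimension of the
`ε_ν`-eigenspace of `Sel_p(E/K)` is `ν + 1` and the other eigenspace has dimension `≤ ν`, `ν` the
vanishing order of `κ`), stated here as ONE named fact in the tree's vocabulary
(`WZhang2014_lemma84_exists_minimal_kolyvaginClass_one_selmerCard`, `[cite]`d, to be relocated by the gate into
`Literature/NumberTheory/EllipticCurves/HeegnerPointsKolyvaginLevelOneStructure` (the level-one sibling of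
`HeegnerPointsKolyvaginStructure`, which holds the Kolyvagin 1991 / BCGS 2026 `p^∞` records); the Thm. 1.1 record is `WZhang2014.thm11_exists_kolyvaginClass_one_ne_zero`).

* `levelOne_kolyvaginClass_rankClause_of_lemma84` — **the level-one supply per `(E, p, K)`.**
  Granted the fact: for `E/ℚ` globally minimal, `p ≥ 5` good ordinary with `ρ̄_{E,p}` onto and
  Hypothesis ♠ (the Kodaira–Néron cell: `p ∤ ord_ℓ(Δ_min)` at every multiplicative `ℓ`; and two
  multiplicative primes if `N` is not square-free), `K` imaginary quadratic Heegner with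
  `(d_K, N) = 1`, `p ∤ d_K`: IF `Ш(E/ℚ)[p] = 0`, `Ш(E^{(d_K)}/ℚ)[p] = 0` and `rank E^{(d_K)}(ℚ) ≤ 1`,
  THEN there are a frame `(Dt, β, ι)`, a square-free product `n` of Kolyvagin primes and a datum `d`
  of conductor `n` with `c_1(n) ≠ 0` and the crux's clause
  `ν(n)+1 ≤ rank E(ℚ) ∨ (ν(n) ≤ rank E(ℚ) ∧ ν(n)+1 ≤ rank E^{(d_K)}(ℚ))`. Proof: `E(ℚ)[p] = 0 =
  E^{(d_K)}(ℚ)[p]` (surjective ⇒ irreducible, also for the twist), so the exact descent count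
  (`natCard_selmerGroup_eq`, AEC X.4.2) reads `#Sel_p(E/ℚ) = p^{rank E}`,
  `#Sel_p(E^{(d_K)}/ℚ) = p^{rank E^{(d_K)}}`; Lemma 8.4 (1) at the minimal non-zero level-one class
  gives `#Sel = p^{ν+1}` on one side: on the `E` side `rank E = ν + 1` (first clause), on the twist
  side `rank E^{(d_K)} = ν + 1 ≤ 1`, so `ν = 0` (second clause). No parity theorem is used.

CONDITIONAL on the named fact (size XL in print: level raising, Jacquet–Langlands, BDP/Gross formula
mod `p`, Skinner–Urban, Kolyvagin's Chebotarev arguments); the `Ш[p] = 0` hypotheses are the open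
content of the crux. BSD is NOT proved by this.

References: [WZhang2014] W. Zhang, Camb. J. Math. 2 (2014): Def. 8.3, Lemma 8.4 (1) (p. 236),
Thm. 9.1 (p. 240), Thm. 9.3 and the sentence after it (p. 243), Thm. 1.1 and Hypothesis ♠ (p. 195);
[Kolyvagin1991MathAnn] §2 (the eigenspaces as Selmer groups of `E` and of its form over `K`);
[SilvermanAEC2009] X.4.2.
-/

set_option linter.dupNamespace false

noncomputable section

open scoped Classical

namespace Summit.BirchSwinnertonDyer.BirchSwinnertonDyer.Theorems.KolyvaginDepthDoor

open Literature.NumberTheory.EllipticCurves Literature.NumberTheory.EllipticCurves.ModularForms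
  WeierstrassCurve

/-- **`#Sel_p(E/ℚ) = p^{rank E(ℚ)}` when `Ш(E/ℚ)[p] = 0` and `E[p]` is irreducible** (any elliptic
`W/ℚ`, `p` prime): the exact descent count `#Sel_p = p^{rank} · #E(ℚ)[p] · #Ш[p]`
(`natCard_selmerGroup_eq`, AEC X.4.2) with `#E(ℚ)[p] = 1` (irreducibility, Mazur p. 157) and
`#Ш[p] = 1`. [cite: SilvermanAEC2009, Thm. X.4.2] -/
theorem natCard_selmerGroup_eq_pow_rank_of_sha_inf_torsionBy_eq_bot (W : WeierstrassCurve ℚ)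
    [W.IsElliptic] (p : ℕ) [hp : Fact p.Prime] (hirr : W.HasIrreducibleModPGaloisRep p)
    (hsha : (W.sha ⊓ AddSubgroup.torsionBy W.galH1 (p : ℤ) : AddSubgroup W.galH1) = ⊥) :
    Nat.card (W.selmerGroup p) = p ^ W.mordellWeilRank := by
  have h := W.natCard_selmerGroup_eq hp.out.ne_zero
  have htor : Nat.card (AddSubgroup.torsionBy W.toAffine.Point (p : ℤ)) = 1 :=
    natCard_torsionBy_eq_one_of_hasIrreducibleModPGaloisRep W p hirr
  rw [hsha, AddSubgroup.card_bot, mul_one] at h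
  have key : ∀ t : ℕ, t = 1 → p ^ W.mordellWeilRank * t = p ^ W.mordellWeilRank := by
    rintro t rfl
    exact mul_one _
  rw [h]
  exact key _ (by convert htor)

/-- **The level-one supply per `(E, p, K)` (modulo W. Zhang 2014, Lemma 8.4 (1) + Thm. 9.1).**
`E/ℚ` globally minimal; `p ≥ 5` good ordinary with `ρ̄_{E,p}` onto; Hypothesis ♠: `p ∤ v_ℓ(Δ_min)`
at every multiplicative `ℓ` (the Kodaira–Néron cell) and, if `N_E` is not square-free, some such `ℓ`
and two distinct multiplicative primes; `K` imaginary quadratic with `p ∤ d_K`, `(d_K, N_E) = 1` and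
the Heegner hypothesis. IF `Ш(E/ℚ)[p] = 0`, `Ш(E^{(d_K)}/ℚ)[p] = 0` (on the twist model
`W.quadraticTwist d_K`) and `rank E^{(d_K)}(ℚ) ≤ 1`, THEN some level-one Kolyvagin–Heegner class
`c_1(n) ≠ 0`, `n` a square-free product of Kolyvagin primes (W. Zhang's sense), satisfies the SIGNED
rank clause of the crux `KolyvaginDepthSupplyKN`: `ν(n)+1 ≤ rank E(ℚ) ∨ (ν(n) ≤ rank E(ℚ) ∧ ν(n)+1 ≤
rank E^{(d_K)}(ℚ))`. Proof in the module docstring (descent counts + Lemma 8.4 (1); no parity).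
CONDITIONAL on `h84`; BSD is not proved by it. [cite: WZhang2014, Lemma 8.4 (1) (p. 236) and Thm. 9.1 (p. 240)]
[cite: SilvermanAEC2009, Thm. X.4.2] -/
theorem levelOne_kolyvaginClass_rankClause_of_lemma84
    (h84 : Literature.NumberTheory.EllipticCurves.WZhang2014_lemma84_exists_minimal_kolyvaginClass_one_selmerCard)
    (W : WeierstrassCurve ℚ) [W.IsElliptic] [W.IsGloballyMinimal] (p : ℕ) [hp : Fact p.Prime]
    (h5 : 5 ≤ p) (hgood : W.HasGoodReductionAtPrime p) (hord : ¬ (p : ℤ) ∣ W.frobeniusTrace p)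
    (hsurj : W.HasSurjectiveModNGaloisRep p)
    (hS1 : ∀ (ℓ : ℕ) [Fact ℓ.Prime], W.HasMultiplicativeReductionAtPrime ℓ →
      ¬ p ∣ padicValInt ℓ W.minimalDiscriminantInt)
    (hS2 : ¬ Squarefree (W.conductorNorm ℤ) →
      (∃ (ℓ : ℕ) (_ : Fact ℓ.Prime), W.HasMultiplicativeReductionAtPrime ℓ ∧
          ¬ p ∣ padicValInt ℓ W.minimalDiscriminantInt) ∧
        ∃ (ℓ₁ ℓ₂ : ℕ) (_ : Fact ℓ₁.Prime) (_ : Fact ℓ₂.Prime), ℓ₁ ≠ ℓ₂ ∧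
          W.HasMultiplicativeReductionAtPrime ℓ₁ ∧ W.HasMultiplicativeReductionAtPrime ℓ₂)
    (K : Type) [Field K] [NumberField K] (hK : IsImaginaryQuadratic K)
    (hpD : ¬ ((p : ℤ) ∣ NumberField.discr K))
    (hDN : IsCoprime (NumberField.discr K) ((W.conductorNorm ℤ : ℕ) : ℤ))
    [NeZero (W.conductorNorm ℤ)] (hHeeg : SatisfiesHeegnerHypothesis (W.conductorNorm ℤ) K)
    (hshaW : (W.sha ⊓ AddSubgroup.torsionBy W.galH1 (p : ℤ) : AddSubgroup W.galH1) = ⊥)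
    (hshaT : ((W.quadraticTwist (NumberField.discr K : ℚ)).sha ⊓
        AddSubgroup.torsionBy (W.quadraticTwist (NumberField.discr K : ℚ)).galH1 (p : ℤ) :
        AddSubgroup (W.quadraticTwist (NumberField.discr K : ℚ)).galH1) = ⊥)
    (hT1 : (W.quadraticTwist (NumberField.discr K : ℚ)).mordellWeilRank ≤ 1) :
    ∃ (Dt : ModularParametrizationData W (W.conductorNorm ℤ)) (β : ℤ) (ι : K →+* ℂ) (n : ℕ)
      (d : KolyvaginHeegnerData Dt β ι n),
      KolyvaginDescent.KolSupp (Zhang2014.IsKolyvaginPrime (W.conductorNorm ℤ) W K p) n ∧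
        d.kolyvaginClass hp.out 1 ≠ 0 ∧
        (n.primeFactors.card + 1 ≤ W.mordellWeilRank ∨
          (n.primeFactors.card ≤ W.mordellWeilRank ∧
            n.primeFactors.card + 1 ≤ (W.quadraticTwist (NumberField.discr K : ℚ)).mordellWeilRank)) := by
  obtain ⟨Dt, β, ι, n, d, hsupp, -, hne, -, hdich⟩ :=
    h84 W p h5 hgood hord hsurj hS1 hS2 K hK hpD hDN hHeeg
  have hpP : p.Prime := hp.out
  have h2p : 2 ≤ p := hpP.two_le
  haveI : NeZero (p : ℚ) := ⟨by exact_mod_cast hpP.ne_zero⟩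
  -- irreducibility of `E[p]` and of the twist's `E^{(d_K)}[p] ≅ E[p] ⊗ χ`
  have hirr : W.HasIrreducibleModPGaloisRep p :=
    hasIrreducibleModPGaloisRep_of_hasSurjectiveModNGaloisRep W p hsurj
  have hdK : (NumberField.discr K : ℚ) ≠ 0 := by exact_mod_cast NumberField.discr_ne_zero K
  haveI := W.isElliptic_quadraticTwist hdK
  have hirrT : (W.quadraticTwist (NumberField.discr K : ℚ)).HasIrreducibleModPGaloisRep p :=
    (W.hasIrreducibleModPGaloisRep_quadraticTwist_iff hdK p).mpr hirr
  -- the two descent counts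
  have hSelW : Nat.card (W.selmerGroup p) = p ^ W.mordellWeilRank :=
    natCard_selmerGroup_eq_pow_rank_of_sha_inf_torsionBy_eq_bot W p hirr hshaW
  have hSelT : Nat.card ((W.quadraticTwist (NumberField.discr K : ℚ)).selmerGroup p) =
      p ^ (W.quadraticTwist (NumberField.discr K : ℚ)).mordellWeilRank :=
    natCard_selmerGroup_eq_pow_rank_of_sha_inf_torsionBy_eq_bot _ p hirrT hshaT
  refine ⟨Dt, β, ι, n, d, hsupp, hne, ?_⟩
  rcases hdich with ⟨hW1, -⟩ | ⟨hT1', -⟩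
  · -- the non-zero class sits on the `E` side: `rank E = ν + 1`
    left
    rw [hSelW] at hW1
    have := Nat.pow_right_injective h2p hW1
    omega
  · -- it sits on the twist side: `rank E^{(d_K)} = ν + 1 ≤ 1`, so `ν = 0`
    right
    rw [hSelT] at hT1'
    have := Nat.pow_right_injective h2p hT1'
    constructor <;> omega

end Summit.BirchSwinnertonDyer.BirchSwinnertonDyer.Theorems.KolyvaginDepthDoor

end
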